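import Summits.ValiantsHypothesis.ValiantsHypothesis.Theorems.DefinabilityGapMergeIsolation
import Summits.ValiantsHypothesis.ValiantsHypothesis.Theorems.DefinabilityGapThreeMatchings
import HarnessLib

/-!
# DefinabilityGap — FOUR-MATCHING SUMS: `G_m` hits `α₁Δ_{M₁} + α₂Δ_{M₂} + α₃Δ_{M₃} + α₄Δ_{M₄}` (`m ≥ 10`)

Route `route-ValiantsHypothesis-DefinabilityGap` (decomp-valiant, lens 5: hardness–randomness / PIT axis); width
road of the read-once leaf F4 / W10 (`KIPlantedHittingRO`, stmt-ValiantsHypothesis-23704, aside), on top of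
`DefinabilityGapMergeIsolation` (★ three-merge isolation, `m ≥ 8`: `coeff_eq_zero_of_threeMerge`),
`DefinabilityGapThreeMatchings` (`kiPer_hits_threeMatchings`, `m ≥ 6`; `card_le_two_of_meet`,
`sdiff_nonempty_of_ne`, `kiPer_dprod_ne_zero`, `isHomogeneous_kiPer_dprod`, `vars_C_mul_dprod_subset`,
`dprod_restrict_eq_zero`) and `DefinabilityGapSupportRung` (`kiPer_hits_support`). `G_m : y ↦ (P_c(y))_c`,
`φ = bind₁ (kiPer m)`, `Δ_M = dprod M = ∏_{(u,v) ∈ M} (z_u − z_v)`.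
ELEMENTARY · NEW-COMBINATION (claimed: y-side = g35's seed-side merge lever iterated through a generic defect
calculus and put in IDEAL form — VARIANT of our own lever; z-side = the near/far dichotomy for matching families,
NEW on this problem) · 0 S-currency · closes NO item · graphical matchings only; fan-in ≥ 5, non-matching
multisets, general affine forms and the leaf regime w = q^b ≫ m NOT claimed · K1 / stmt-23704 / VP ≠ VNP untouched.

## ★ `kiPer_hits_fourMatchings` (`m ≥ 10`): statement and proof

For ORIENTED MATCHINGS `M₁, …, M₄` of blocks (F-E's hypotheses: `ho_j`, `u < v` lexicographically on each edge;
`hd_j`, distinct edges vertex-disjoint) and `α ∈ ℂ⁴`: `f = Σ α_jΔ_{M_j} ≠ 0 ⟹ f(G_m) ≠ 0` — no width, degree, size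
or number-of-blocks hypothesis. Suppose `φ f = 0`. (i) Some `α_j = 0`: three terms (`kiPer_hits_threeMatchings`).
(ii) DEGREE FILTER (`sizes_eq`): `φΔ_M` is homogeneous of degree `m|M|`, so the degree-`m|M₁|` part of `f` and the
rest are killed separately; unless all sizes agree each has `≤ 3` terms, hence vanishes, and `f = 0`. (iii) Equal
matchings: merge coefficients. (iv) NEAR/FAR DICHOTOMY (`card_sdiff_le_four`): if `|M₂ ∖ M₁| ≥ 5` then every
`e₃ ∈ M₃ ∖ M₁` MEETS every `e₄ ∈ M₄ ∖ M₁` (`meet_of_five`) — else at most `4` edges of the matching `M₂` touch their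
four endpoints (`card_le_four_of_meet`), some `e₂ ∈ M₂ ∖ M₁` avoids both, and the pairwise disjoint exclusive edges
`e₂, e₃, e₄` (absent from `M₁` in both orientations) ISOLATE the first term: `coeff_eq_zero_of_threeMerge`,
`α₁ = 0` —; so `|M₃ ∖ M₁| ≤ 2` (`card_le_two_of_meet` against a fixed `e₄ ∈ M₄ ∖ M₁ ≠ ∅`), likewise
`|M₃ ∖ M₂| ≤ 2`, and `|M₂ ∖ M₁| ≤ |M₂ ∖ M₃| + |M₃ ∖ M₁| = |M₃ ∖ M₂| + |M₃ ∖ M₁| ≤ 4` ✗. (v) So all `|M_i ∖ M_j| ≤ 4`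
(`1 ∈ {i, j}`): at most `24` edges lie outside the core `C = ⋂_j M_j`, `f = Δ_C·f̂`, `φΔ_C ≠ 0`, `f̂ ≠ 0` lives on
`≤ 48` blocks, and `2·47 = 94 < 100 ≤ m²` (`kiPer_hits_support`) ✗. Rigid K₄ / Plücker configurations are the NEAR
branch and fall to the support rung: no K₄ lemma. Thresholds: `m ≥ 8` for the three-merge lemma (patch budget
`26`, `2 + 52 < 64`), `m ≥ 10` for ★ (`94 < 100`).

## Members (K6 non-vacuity) in the majority ideal; HONEST BOUNDARY

Members: F-E's family on `2n` blocks `c_1, …, c_{2n}` (`n ≥ 3`) — `M₁ = {(c_{2i−1}, c_{2i})}`, `M₂ = {(c_{2i},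
c_{2i+1})} ∪ {(c_{2n}, c_1)}`, `M₃ = {(c_{4i−3}, c_{4i−1}), (c_{4i−2}, c_{4i})}` — plus `M₄ = {(c_{4i−3}, c_{4i}),
(c_{4i−2}, c_{4i−1})}` (`M₁, M₃, M₄`: the three perfect matchings of each aligned 4-group — the K₄ / Plücker
configuration): degree `n`, read-once of ROABP width `≤ 14` in the block order, fan-in `4`, `f ≠ 0` for `α ≠ 0`;
for `n ≥ ⌈m/2⌉` each `Δ_{M_j}` lies in the majority ideal `I_{⌈m/2⌉−1}` BY NAME (`dprod_restrict_eq_zero`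
termwise: restricted to `≤ n − 1` free blocks it vanishes at every base point) — outside every restriction road,
the degree road, sparsity, ΣΠΣ(2), width 2 and the three-matching theorem. HONEST BOUNDARY: fan-in 5 follows the
same near/far dichotomy ON PAPER (four disjoint merges, budget `80`, `m ≥ 13`; support `≤ 64` edges, `m ≥ 16`) —
NOT built; fan-in 6 is the CEILING of «single-term isolation + bounded exclusive support»: two far-apart
K₄-clusters (`M_{2s−1}, M_{2s}` differing only inside cluster `s`) admit no single-term isolation and have
unbounded exclusive support — CLUSTER isolation over patched word families is idea currency only; non-matching
MULTISETS are NOT claimed (merge selection must act on term rank: `x³ + y³ − (x+y)³ = −3xy(x+y)`), nor general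
affine forms, nor the leaf regime w = q^b ≫ m; K1 / stmt-23704 / VP ≠ VNP untouched.
-/

noncomputable section

open MvPolynomial
open Literature.Computability.AlgebraicComplexity Literature.Computability.MetaComplexity
open Summit.ValiantsHypothesis.ValiantsHypothesis.Theorems.DefinabilityGapAffineRung
open Summit.ValiantsHypothesis.ValiantsHypothesis.Theorems.DefinabilityGapSupportRung
open Summit.ValiantsHypothesis.ValiantsHypothesis.Theorems.DefinabilityGapBlockMerging
open Summit.ValiantsHypothesis.ValiantsHypothesis.Theorems.DefinabilityGapThreeMatchings
open Summit.ValiantsHypothesis.ValiantsHypothesis.Theorems.DefinabilityGapMergeIsolation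

set_option linter.dupNamespace false

namespace Summit.ValiantsHypothesis.ValiantsHypothesis.Theorems.DefinabilityGapFourMatchings

variable {m : ℕ}

/-! ## 1. Three terms, and four vertices -/

/-- The three-matching theorem contraposed: a three-matching sum killed by `φ` is `0` (`m ≥ 6`). [this file] -/
theorem threeTerm_eq_zero (hm : 6 ≤ m) {N₁ N₂ N₃ : Finset ((Fin 3 → Fin (qOf m)) × (Fin 3 → Fin (qOf m)))}
    (ho₁ : ∀ e ∈ N₁, toLex e.1 < toLex e.2) (ho₂ : ∀ e ∈ N₂, toLex e.1 < toLex e.2)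
    (ho₃ : ∀ e ∈ N₃, toLex e.1 < toLex e.2)
    (hd₁ : ∀ e ∈ N₁, ∀ e' ∈ N₁, e ≠ e' → e.1 ≠ e'.1 ∧ e.1 ≠ e'.2 ∧ e.2 ≠ e'.1 ∧ e.2 ≠ e'.2)
    (hd₂ : ∀ e ∈ N₂, ∀ e' ∈ N₂, e ≠ e' → e.1 ≠ e'.1 ∧ e.1 ≠ e'.2 ∧ e.2 ≠ e'.1 ∧ e.2 ≠ e'.2)
    (hd₃ : ∀ e ∈ N₃, ∀ e' ∈ N₃, e ≠ e' → e.1 ≠ e'.1 ∧ e.1 ≠ e'.2 ∧ e.2 ≠ e'.1 ∧ e.2 ≠ e'.2) {γ₁ γ₂ γ₃ : ℂ}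
    (h0 : bind₁ (kiPer m) (C γ₁ * dprod N₁ + C γ₂ * dprod N₂ + C γ₃ * dprod N₃) = 0) :
    C γ₁ * dprod N₁ + C γ₂ * dprod N₂ + C γ₃ * dprod N₃ = 0 := by
  by_contra h; exact kiPer_hits_threeMatchings hm ho₁ ho₂ ho₃ hd₁ hd₂ hd₃ h h0

/-- A matching each of whose edges meets one of two fixed pairs has at most four edges (`card_le_two_of_meet` on
the two halves). [this file] -/
theorem card_le_four_of_meet {A : Finset ((Fin 3 → Fin (qOf m)) × (Fin 3 → Fin (qOf m)))}
    (hA : ∀ e ∈ A, ∀ e' ∈ A, e ≠ e' → e.1 ≠ e'.1 ∧ e.1 ≠ e'.2 ∧ e.2 ≠ e'.1 ∧ e.2 ≠ e'.2)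
    (x y z w : Fin 3 → Fin (qOf m)) (hmeet : ∀ e ∈ A,
      ¬(e.1 ≠ x ∧ e.1 ≠ y ∧ e.2 ≠ x ∧ e.2 ≠ y) ∨ ¬(e.1 ≠ z ∧ e.1 ≠ w ∧ e.2 ≠ z ∧ e.2 ≠ w)) : A.card ≤ 4 := by
  have sub : ∀ (p : (Fin 3 → Fin (qOf m)) × (Fin 3 → Fin (qOf m)) → Prop) [DecidablePred p],
      ∀ e ∈ A.filter p, ∀ e' ∈ A.filter p, e ≠ e' → e.1 ≠ e'.1 ∧ e.1 ≠ e'.2 ∧ e.2 ≠ e'.1 ∧ e.2 ≠ e'.2 :=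
    fun p _ e he e' he' hne => hA e (Finset.mem_filter.1 he).1 e' (Finset.mem_filter.1 he').1 hne
  have h1 : (A.filter fun e => ¬(e.1 ≠ x ∧ e.1 ≠ y ∧ e.2 ≠ x ∧ e.2 ≠ y)).card ≤ 2 :=
    card_le_two_of_meet (sub _) x y fun e he => (Finset.mem_filter.1 he).2
  have h2 : (A.filter fun e => ¬¬(e.1 ≠ x ∧ e.1 ≠ y ∧ e.2 ≠ x ∧ e.2 ≠ y)).card ≤ 2 :=
    card_le_two_of_meet (sub _) z w fun e he =>
      (hmeet e (Finset.mem_filter.1 he).1).resolve_left (Finset.mem_filter.1 he).2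
  have h := (Finset.card_filter_add_card_filter_not (s := A)
    (fun e => ¬(e.1 ≠ x ∧ e.1 ≠ y ∧ e.2 ≠ x ∧ e.2 ≠ y))).symm.trans_le (add_le_add h1 h2)
  omega

/-! ## 2. Isolation by three exclusive edges; the near/far dichotomy -/

/-- Three pairwise vertex-disjoint exclusive edges `e_j ∈ N_j ∖ N₁` (`j = 2,3,4`) isolate the first term:
`φ(α₁Δ_{N₁} + α₂Δ_{N₂} + α₃Δ_{N₃} + α₄Δ_{N₄}) = 0 ⟹ α₁ = 0` — the three-merge lemma `coeff_eq_zero_of_threeMerge`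
(orientation excludes the reversed edges from `N₁`). [this file] -/
theorem coeff_eq_zero_of_triple (hm : 8 ≤ m) {N₁ N₂ N₃ N₄ : Finset ((Fin 3 → Fin (qOf m)) × (Fin 3 → Fin (qOf m)))}
    (ho₁ : ∀ e ∈ N₁, toLex e.1 < toLex e.2) (ho₂ : ∀ e ∈ N₂, toLex e.1 < toLex e.2)
    (ho₃ : ∀ e ∈ N₃, toLex e.1 < toLex e.2) (ho₄ : ∀ e ∈ N₄, toLex e.1 < toLex e.2)
    {e₂ e₃ e₄ : (Fin 3 → Fin (qOf m)) × (Fin 3 → Fin (qOf m))} (h₂ : e₂ ∈ N₂) (h₂' : e₂ ∉ N₁) (h₃ : e₃ ∈ N₃)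
    (h₃' : e₃ ∉ N₁) (h₄ : e₄ ∈ N₄) (h₄' : e₄ ∉ N₁)
    (d₂₃ : e₂.1 ≠ e₃.1 ∧ e₂.1 ≠ e₃.2 ∧ e₂.2 ≠ e₃.1 ∧ e₂.2 ≠ e₃.2)
    (d₂₄ : e₂.1 ≠ e₄.1 ∧ e₂.1 ≠ e₄.2 ∧ e₂.2 ≠ e₄.1 ∧ e₂.2 ≠ e₄.2)
    (d₃₄ : e₃.1 ≠ e₄.1 ∧ e₃.1 ≠ e₄.2 ∧ e₃.2 ≠ e₄.1 ∧ e₃.2 ≠ e₄.2) {α₁ α₂ α₃ α₄ : ℂ}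
    (h0 : bind₁ (kiPer m) (C α₁ * dprod N₁ + C α₂ * dprod N₂ + C α₃ * dprod N₃ + C α₄ * dprod N₄) = 0) :
    α₁ = 0 := by
  obtain ⟨a₁, b₁⟩ := e₂; obtain ⟨a₂, b₂⟩ := e₃; obtain ⟨a₃, b₃⟩ := e₄
  exact coeff_eq_zero_of_threeMerge (a₁ := a₁) (b₁ := b₁) (a₂ := a₂) (b₂ := b₂) (a₃ := a₃) (b₃ := b₃) hm
    (loopless_of_oriented ho₂ _ h₂) (loopless_of_oriented ho₃ _ h₃) (loopless_of_oriented ho₄ _ h₄) d₂₃ d₂₄ d₃₄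
    h₂ h₃ h₄ (fun e he => ⟨loopless_of_oriented ho₁ e he, fun hq => h₂' (hq ▸ he),
      fun hq => not_mem_swap_of_oriented ho₂ ho₁ h₂ (hq ▸ he), fun hq => h₃' (hq ▸ he),
      fun hq => not_mem_swap_of_oriented ho₃ ho₁ h₃ (hq ▸ he), fun hq => h₄' (hq ▸ he),
      fun hq => not_mem_swap_of_oriented ho₄ ho₁ h₄ (hq ▸ he)⟩) h0

/-- FAR ⟹ LOCKED: if `α₁ ≠ 0` and the matching `N₂` has `≥ 5` edges outside `N₁`, then every edge of `N₃ ∖ N₁`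
meets every edge of `N₄ ∖ N₁` (else some exclusive edge of `N₂` avoids both and `coeff_eq_zero_of_triple` kills
`α₁`). [this file] -/
theorem meet_of_five (hm : 8 ≤ m) {N₁ N₂ N₃ N₄ : Finset ((Fin 3 → Fin (qOf m)) × (Fin 3 → Fin (qOf m)))}
    (ho₁ : ∀ e ∈ N₁, toLex e.1 < toLex e.2) (ho₂ : ∀ e ∈ N₂, toLex e.1 < toLex e.2)
    (ho₃ : ∀ e ∈ N₃, toLex e.1 < toLex e.2) (ho₄ : ∀ e ∈ N₄, toLex e.1 < toLex e.2)
    (hd₂ : ∀ e ∈ N₂, ∀ e' ∈ N₂, e ≠ e' → e.1 ≠ e'.1 ∧ e.1 ≠ e'.2 ∧ e.2 ≠ e'.1 ∧ e.2 ≠ e'.2) {α₁ α₂ α₃ α₄ : ℂ}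
    (hα₁ : α₁ ≠ 0) (h5 : 4 < (N₂ \ N₁).card)
    (h0 : bind₁ (kiPer m) (C α₁ * dprod N₁ + C α₂ * dprod N₂ + C α₃ * dprod N₃ + C α₄ * dprod N₄) = 0) :
    ∀ e₃ ∈ N₃ \ N₁, ∀ e₄ ∈ N₄ \ N₁, ¬(e₃.1 ≠ e₄.1 ∧ e₃.1 ≠ e₄.2 ∧ e₃.2 ≠ e₄.1 ∧ e₃.2 ≠ e₄.2) := by
  intro e₃ he₃ e₄ he₄ d₃₄
  rw [Finset.mem_sdiff] at he₃ he₄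
  have hmeet : ∀ e ∈ N₂ \ N₁, ¬(e.1 ≠ e₃.1 ∧ e.1 ≠ e₃.2 ∧ e.2 ≠ e₃.1 ∧ e.2 ≠ e₃.2) ∨
      ¬(e.1 ≠ e₄.1 ∧ e.1 ≠ e₄.2 ∧ e.2 ≠ e₄.1 ∧ e.2 ≠ e₄.2) := by
    intro e he
    rw [Finset.mem_sdiff] at he
    by_contra hno
    rw [not_or, not_not, not_not] at hno
    exact hα₁ (coeff_eq_zero_of_triple hm ho₁ ho₂ ho₃ ho₄ he.1 he.2 he₃.1 he₃.2 he₄.1 he₄.2 hno.1 hno.2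
      d₃₄ h0)
  have h4 := card_le_four_of_meet (fun e he e' he' hne => hd₂ e (Finset.mem_sdiff.1 he).1 e'
    (Finset.mem_sdiff.1 he').1 hne) _ _ _ _ hmeet
  omega

/-- ★ THE NEAR/FAR DICHOTOMY (`m ≥ 8`): with `α₁, α₂ ≠ 0`, equal sizes and `N₄ ≠ N₁, N₂`, the matching `N₂` has at
most `4` edges outside `N₁`. If not, `meet_of_five` (for the terms `1` and `2`) bounds `|N₃ ∖ N₁|, |N₃ ∖ N₂| ≤ 2`
(`card_le_two_of_meet` against fixed exclusive edges of `N₄`), and the triangle inequality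
`|N₂ ∖ N₁| ≤ |N₂ ∖ N₃| + |N₃ ∖ N₁| = |N₃ ∖ N₂| + |N₃ ∖ N₁| ≤ 4` contradicts `≥ 5`. [this file] -/
theorem card_sdiff_le_four (hm : 8 ≤ m) {N₁ N₂ N₃ N₄ : Finset ((Fin 3 → Fin (qOf m)) × (Fin 3 → Fin (qOf m)))}
    (ho₁ : ∀ e ∈ N₁, toLex e.1 < toLex e.2) (ho₂ : ∀ e ∈ N₂, toLex e.1 < toLex e.2)
    (ho₃ : ∀ e ∈ N₃, toLex e.1 < toLex e.2) (ho₄ : ∀ e ∈ N₄, toLex e.1 < toLex e.2)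
    (hd₁ : ∀ e ∈ N₁, ∀ e' ∈ N₁, e ≠ e' → e.1 ≠ e'.1 ∧ e.1 ≠ e'.2 ∧ e.2 ≠ e'.1 ∧ e.2 ≠ e'.2)
    (hd₂ : ∀ e ∈ N₂, ∀ e' ∈ N₂, e ≠ e' → e.1 ≠ e'.1 ∧ e.1 ≠ e'.2 ∧ e.2 ≠ e'.1 ∧ e.2 ≠ e'.2)
    (hd₃ : ∀ e ∈ N₃, ∀ e' ∈ N₃, e ≠ e' → e.1 ≠ e'.1 ∧ e.1 ≠ e'.2 ∧ e.2 ≠ e'.1 ∧ e.2 ≠ e'.2)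
    {α₁ α₂ α₃ α₄ : ℂ} (hα₁ : α₁ ≠ 0) (hα₂ : α₂ ≠ 0) (e₁₂ : N₁.card = N₂.card) (e₂₃ : N₂.card = N₃.card)
    (e₁₄ : N₁.card = N₄.card) (q₄₁ : N₄ ≠ N₁) (q₄₂ : N₄ ≠ N₂)
    (h0 : bind₁ (kiPer m) (C α₁ * dprod N₁ + C α₂ * dprod N₂ + C α₃ * dprod N₃ + C α₄ * dprod N₄) = 0) :
    (N₂ \ N₁).card ≤ 4 := by
  by_contra h5
  rw [not_le] at h5
  have h5' : 4 < (N₁ \ N₂).card := by rw [Finset.card_sdiff_comm e₁₂]; exact h5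
  have h0' : bind₁ (kiPer m) (C α₂ * dprod N₂ + C α₁ * dprod N₁ + C α₃ * dprod N₃ + C α₄ * dprod N₄) = 0 := by
    rw [add_comm (C α₂ * dprod N₂)]; exact h0
  obtain ⟨u, hu⟩ := sdiff_nonempty_of_ne q₄₁ e₁₄.le
  obtain ⟨v, hv⟩ := sdiff_nonempty_of_ne q₄₂ (e₁₂.symm.trans e₁₄).le
  have hA := meet_of_five hm ho₁ ho₂ ho₃ ho₄ hd₂ hα₁ h5 h0
  have hB := meet_of_five hm ho₂ ho₁ ho₃ ho₄ hd₁ hα₂ h5' h0'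
  have sub : ∀ {s t : Finset ((Fin 3 → Fin (qOf m)) × (Fin 3 → Fin (qOf m)))},
      (∀ e ∈ s, ∀ e' ∈ s, e ≠ e' → e.1 ≠ e'.1 ∧ e.1 ≠ e'.2 ∧ e.2 ≠ e'.1 ∧ e.2 ≠ e'.2) →
      ∀ e ∈ s \ t, ∀ e' ∈ s \ t, e ≠ e' → e.1 ≠ e'.1 ∧ e.1 ≠ e'.2 ∧ e.2 ≠ e'.1 ∧ e.2 ≠ e'.2 :=
    fun hs e he e' he' hne => hs e (Finset.mem_sdiff.1 he).1 e' (Finset.mem_sdiff.1 he').1 hne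
  have b₃₁ : (N₃ \ N₁).card ≤ 2 := card_le_two_of_meet (sub hd₃) u.1 u.2 fun e he hd => hA e he u hu hd
  have b₃₂ : (N₃ \ N₂).card ≤ 2 := card_le_two_of_meet (sub hd₃) v.1 v.2 fun e he hd => hB e he v hv hd
  have tri : N₂ \ N₁ ⊆ N₂ \ N₃ ∪ N₃ \ N₁ := by
    intro e he
    rw [Finset.mem_sdiff] at he
    rw [Finset.mem_union, Finset.mem_sdiff, Finset.mem_sdiff]
    by_cases h3 : e ∈ N₃
    · exact Or.inr ⟨h3, he.2⟩
    · exact Or.inl ⟨he.1, h3⟩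
  have c₂₃ := Finset.card_sdiff_comm e₂₃
  have hle := (Finset.card_le_card tri).trans (Finset.card_union_le _ _)
  omega

/-! ## 3. The degree filter -/

/-- (ii) DEGREE FILTER: if `φ` kills a nonzero four-matching sum then the four sizes agree — else the
degree-`|M₁|m` part and the rest are three-matching sums killed by `φ`, hence `0`. [this file] -/
theorem sizes_eq (hm : 6 ≤ m) {M₁ M₂ M₃ M₄ : Finset ((Fin 3 → Fin (qOf m)) × (Fin 3 → Fin (qOf m)))}
    (ho₁ : ∀ e ∈ M₁, toLex e.1 < toLex e.2) (ho₂ : ∀ e ∈ M₂, toLex e.1 < toLex e.2)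
    (ho₃ : ∀ e ∈ M₃, toLex e.1 < toLex e.2) (ho₄ : ∀ e ∈ M₄, toLex e.1 < toLex e.2)
    (hd₁ : ∀ e ∈ M₁, ∀ e' ∈ M₁, e ≠ e' → e.1 ≠ e'.1 ∧ e.1 ≠ e'.2 ∧ e.2 ≠ e'.1 ∧ e.2 ≠ e'.2)
    (hd₂ : ∀ e ∈ M₂, ∀ e' ∈ M₂, e ≠ e' → e.1 ≠ e'.1 ∧ e.1 ≠ e'.2 ∧ e.2 ≠ e'.1 ∧ e.2 ≠ e'.2)
    (hd₃ : ∀ e ∈ M₃, ∀ e' ∈ M₃, e ≠ e' → e.1 ≠ e'.1 ∧ e.1 ≠ e'.2 ∧ e.2 ≠ e'.1 ∧ e.2 ≠ e'.2)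
    (hd₄ : ∀ e ∈ M₄, ∀ e' ∈ M₄, e ≠ e' → e.1 ≠ e'.1 ∧ e.1 ≠ e'.2 ∧ e.2 ≠ e'.1 ∧ e.2 ≠ e'.2) {α₁ α₂ α₃ α₄ : ℂ}
    (hf : C α₁ * dprod M₁ + C α₂ * dprod M₂ + C α₃ * dprod M₃ + C α₄ * dprod M₄ ≠ 0)
    (h0 : bind₁ (kiPer m) (C α₁ * dprod M₁ + C α₂ * dprod M₂ + C α₃ * dprod M₃ + C α₄ * dprod M₄) = 0) :
    M₂.card = M₁.card ∧ M₃.card = M₁.card ∧ M₄.card = M₁.card := by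
  by_contra hne
  have hm0 : 0 < m := by omega
  -- the coefficients of the degree-`|M₁|m` part
  obtain ⟨β, hβ⟩ : ∃ β : Finset ((Fin 3 → Fin (qOf m)) × (Fin 3 → Fin (qOf m))) → ℂ → ℂ,
      ∀ N γ, β N γ = if N.card = M₁.card then γ else 0 :=
    ⟨fun N γ => if N.card = M₁.card then γ else 0, fun _ _ => rfl⟩
  have hβ₁ : ∀ {N : Finset ((Fin 3 → Fin (qOf m)) × (Fin 3 → Fin (qOf m)))} (γ : ℂ),
      N.card = M₁.card → β N γ = γ := fun γ h => by rw [hβ, if_pos h]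
  have hβ₀ : ∀ {N : Finset ((Fin 3 → Fin (qOf m)) × (Fin 3 → Fin (qOf m)))} (γ : ℂ),
      N.card ≠ M₁.card → β N γ = 0 := fun γ h => by rw [hβ, if_neg h]
  have key : ∀ (N : Finset ((Fin 3 → Fin (qOf m)) × (Fin 3 → Fin (qOf m)))) (γ : ℂ),
      homogeneousComponent (M₁.card * m) (bind₁ (kiPer m) (C γ * dprod N)) =
        bind₁ (kiPer m) (C (β N γ) * dprod N) := by
    intro N γ
    rw [map_mul, bind₁_C_right, homogeneousComponent_C_mul,
      homogeneousComponent_of_mem (isHomogeneous_kiPer_dprod N), map_mul, bind₁_C_right]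
    by_cases h : N.card = M₁.card
    · rw [if_pos (show M₁.card * m = N.card * m by rw [h]), hβ₁ γ h]
    · rw [if_neg (show ¬(M₁.card * m = N.card * m) from fun e => h (Nat.eq_of_mul_eq_mul_right hm0 e).symm),
        hβ₀ γ h, C_0, zero_mul, mul_zero]
  -- `φ` kills the degree-`|M₁|m` part …
  have hc := congrArg (homogeneousComponent (M₁.card * m)) h0
  simp only [map_add, map_zero] at hc
  rw [key, key, key, key] at hc
  -- … and the rest, which misses `M₁`
  have hr : bind₁ (kiPer m) (C (α₂ - β M₂ α₂) * dprod M₂ + C (α₃ - β M₃ α₃) * dprod M₃ +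
      C (α₄ - β M₄ α₄) * dprod M₄) = 0 := by
    have h0' := h0
    have hc' := hc
    rw [hβ₁ (N := M₁) α₁ rfl] at hc'
    simp only [map_add, map_sub, map_mul, bind₁_C_right] at h0' hc' ⊢
    linear_combination h0' - hc'
  have Er := threeTerm_eq_zero hm ho₂ ho₃ ho₄ hd₂ hd₃ hd₄ hr
  -- the degree-`|M₁|m` part misses some `M_j`, `j ≥ 2`
  have Eβ : C (β M₁ α₁) * dprod M₁ + C (β M₂ α₂) * dprod M₂ + C (β M₃ α₃) * dprod M₃ +
      C (β M₄ α₄) * dprod M₄ = 0 := by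
    rw [← map_add, ← map_add, ← map_add] at hc
    by_cases h2 : M₂.card = M₁.card
    · by_cases h3 : M₃.card = M₁.card
      · have h4 : M₄.card ≠ M₁.card := fun h4 => hne ⟨h2, h3, h4⟩
        rw [hβ₀ α₄ h4, C_0, zero_mul, add_zero] at hc ⊢
        exact threeTerm_eq_zero hm ho₁ ho₂ ho₃ hd₁ hd₂ hd₃ hc
      · rw [hβ₀ α₃ h3, C_0, zero_mul, add_zero] at hc ⊢
        exact threeTerm_eq_zero hm ho₁ ho₂ ho₄ hd₁ hd₂ hd₄ hc
    · rw [hβ₀ α₂ h2, C_0, zero_mul, add_zero] at hc ⊢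
      exact threeTerm_eq_zero hm ho₁ ho₃ ho₄ hd₁ hd₃ hd₄ hc
  rw [hβ₁ (N := M₁) α₁ rfl] at Eβ
  simp only [map_sub] at Er
  exact hf (by linear_combination Eβ + Er)

/-! ## 4. ★ The four-matching theorem -/

/-- ★ **`G_m` hits four matchings** (`m ≥ 10`, KERNEL, unconditional): for oriented matchings `M₁, M₂, M₃, M₄` of
blocks (`ho_j`: edges `u < v` lexicographically; `hd_j`: distinct edges vertex-disjoint) and scalars
`α₁, α₂, α₃, α₄`, if `f = α₁Δ_{M₁} + α₂Δ_{M₂} + α₃Δ_{M₃} + α₄Δ_{M₄} ≠ 0` then `f(G_m) ≠ 0` — no width, degree, size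
or number-of-blocks hypothesis. ELEMENTARY · NEW-COMBINATION · 0 S-currency · closes NO item; settles the
four-matching sums inside the majority-ideal residual; fan-in ≥ 5 / general multisets / affine / leaf regime NOT
claimed. [this file] -/
theorem kiPer_hits_fourMatchings (hm : 10 ≤ m)
    {M₁ M₂ M₃ M₄ : Finset ((Fin 3 → Fin (qOf m)) × (Fin 3 → Fin (qOf m)))}
    (ho₁ : ∀ e ∈ M₁, toLex e.1 < toLex e.2) (ho₂ : ∀ e ∈ M₂, toLex e.1 < toLex e.2)
    (ho₃ : ∀ e ∈ M₃, toLex e.1 < toLex e.2) (ho₄ : ∀ e ∈ M₄, toLex e.1 < toLex e.2)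
    (hd₁ : ∀ e ∈ M₁, ∀ e' ∈ M₁, e ≠ e' → e.1 ≠ e'.1 ∧ e.1 ≠ e'.2 ∧ e.2 ≠ e'.1 ∧ e.2 ≠ e'.2)
    (hd₂ : ∀ e ∈ M₂, ∀ e' ∈ M₂, e ≠ e' → e.1 ≠ e'.1 ∧ e.1 ≠ e'.2 ∧ e.2 ≠ e'.1 ∧ e.2 ≠ e'.2)
    (hd₃ : ∀ e ∈ M₃, ∀ e' ∈ M₃, e ≠ e' → e.1 ≠ e'.1 ∧ e.1 ≠ e'.2 ∧ e.2 ≠ e'.1 ∧ e.2 ≠ e'.2)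
    (hd₄ : ∀ e ∈ M₄, ∀ e' ∈ M₄, e ≠ e' → e.1 ≠ e'.1 ∧ e.1 ≠ e'.2 ∧ e.2 ≠ e'.1 ∧ e.2 ≠ e'.2)
    {α₁ α₂ α₃ α₄ : ℂ} (hf : C α₁ * dprod M₁ + C α₂ * dprod M₂ + C α₃ * dprod M₃ + C α₄ * dprod M₄ ≠ 0) :
    bind₁ (kiPer m) (C α₁ * dprod M₁ + C α₂ * dprod M₂ + C α₃ * dprod M₃ + C α₄ * dprod M₄) ≠ 0 := by
  intro h0
  obtain ⟨hm3, hm6, hm8⟩ : 3 ≤ m ∧ 6 ≤ m ∧ 8 ≤ m := ⟨by omega, by omega, by omega⟩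
  -- (i) all four coefficients are nonzero
  have hα₁ : α₁ ≠ 0 := by
    rintro rfl; rw [C_0, zero_mul, zero_add] at hf h0
    exact kiPer_hits_threeMatchings hm6 ho₂ ho₃ ho₄ hd₂ hd₃ hd₄ hf h0
  have hα₂ : α₂ ≠ 0 := by
    rintro rfl; rw [C_0, zero_mul, add_zero] at hf h0
    exact kiPer_hits_threeMatchings hm6 ho₁ ho₃ ho₄ hd₁ hd₃ hd₄ hf h0
  have hα₃ : α₃ ≠ 0 := by
    rintro rfl; rw [C_0, zero_mul, add_zero] at hf h0
    exact kiPer_hits_threeMatchings hm6 ho₁ ho₂ ho₄ hd₁ hd₂ hd₄ hf h0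
  have hα₄ : α₄ ≠ 0 := by
    rintro rfl; rw [C_0, zero_mul, add_zero] at hf h0
    exact kiPer_hits_threeMatchings hm6 ho₁ ho₂ ho₃ hd₁ hd₂ hd₃ hf h0
  -- (ii) the four sizes agree
  obtain ⟨e₂, e₃, e₄⟩ := sizes_eq hm6 ho₁ ho₂ ho₃ ho₄ hd₁ hd₂ hd₃ hd₄ hf h0
  -- (iii) the matchings `M₃ ≠ M₁`, `M₄ ≠ M₁, M₂, M₃` (else merge coefficients: three terms)
  by_cases c₃₁ : M₃ = M₁
  · rw [c₃₁, show C α₁ * dprod M₁ + C α₂ * dprod M₂ + C α₃ * dprod M₁ + C α₄ * dprod M₄ =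
      C (α₁ + α₃) * dprod M₁ + C α₂ * dprod M₂ + C α₄ * dprod M₄ from by rw [C_add]; ring] at hf h0
    exact kiPer_hits_threeMatchings hm6 ho₁ ho₂ ho₄ hd₁ hd₂ hd₄ hf h0
  by_cases c₄₁ : M₄ = M₁
  · rw [c₄₁, show C α₁ * dprod M₁ + C α₂ * dprod M₂ + C α₃ * dprod M₃ + C α₄ * dprod M₁ =
      C (α₁ + α₄) * dprod M₁ + C α₂ * dprod M₂ + C α₃ * dprod M₃ from by rw [C_add]; ring] at hf h0
    exact kiPer_hits_threeMatchings hm6 ho₁ ho₂ ho₃ hd₁ hd₂ hd₃ hf h0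
  by_cases c₄₂ : M₄ = M₂
  · rw [c₄₂, show C α₁ * dprod M₁ + C α₂ * dprod M₂ + C α₃ * dprod M₃ + C α₄ * dprod M₂ =
      C α₁ * dprod M₁ + C (α₂ + α₄) * dprod M₂ + C α₃ * dprod M₃ from by rw [C_add]; ring] at hf h0
    exact kiPer_hits_threeMatchings hm6 ho₁ ho₂ ho₃ hd₁ hd₂ hd₃ hf h0
  by_cases c₄₃ : M₄ = M₃
  · rw [c₄₃, show C α₁ * dprod M₁ + C α₂ * dprod M₂ + C α₃ * dprod M₃ + C α₄ * dprod M₃ =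
      C α₁ * dprod M₁ + C α₂ * dprod M₂ + C (α₃ + α₄) * dprod M₃ from by rw [C_add]; ring] at hf h0
    exact kiPer_hits_threeMatchings hm6 ho₁ ho₂ ho₃ hd₁ hd₂ hd₃ hf h0
  -- (iv) the near/far dichotomy for the pairs `(1,2)`, `(1,3)`, `(1,4)`
  have h0₃ : bind₁ (kiPer m) (C α₁ * dprod M₁ + C α₃ * dprod M₃ + C α₂ * dprod M₂ + C α₄ * dprod M₄) = 0 := by
    rw [add_right_comm (C α₁ * dprod M₁)]; exact h0
  have h0₄ : bind₁ (kiPer m) (C α₁ * dprod M₁ + C α₄ * dprod M₄ + C α₂ * dprod M₂ + C α₃ * dprod M₃) = 0 := by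
    rw [add_right_comm (C α₁ * dprod M₁), add_right_comm (C α₁ * dprod M₁ + C α₂ * dprod M₂)]; exact h0
  have b₂₁ := card_sdiff_le_four hm8 ho₁ ho₂ ho₃ ho₄ hd₁ hd₂ hd₃ hα₁ hα₂ e₂.symm (e₂.trans e₃.symm) e₄.symm
    c₄₁ c₄₂ h0
  have b₃₁ := card_sdiff_le_four hm8 ho₁ ho₃ ho₂ ho₄ hd₁ hd₃ hd₂ hα₁ hα₃ e₃.symm (e₃.trans e₂.symm) e₄.symm
    c₄₁ c₄₃ h0₃
  have b₄₁ := card_sdiff_le_four hm8 ho₁ ho₄ ho₂ ho₃ hd₁ hd₄ hd₂ hα₁ hα₄ e₄.symm (e₄.trans e₂.symm) e₃.symm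
    c₃₁ (fun h => c₄₃ h.symm) h0₄
  have b₁₂ : (M₁ \ M₂).card ≤ 4 := by rw [Finset.card_sdiff_comm e₂.symm]; exact b₂₁
  have b₁₃ : (M₁ \ M₃).card ≤ 4 := by rw [Finset.card_sdiff_comm e₃.symm]; exact b₃₁
  have b₁₄ : (M₁ \ M₄).card ≤ 4 := by rw [Finset.card_sdiff_comm e₄.symm]; exact b₄₁
  -- (v) at most `24` exclusive edges `D` outside the common core `K`
  obtain ⟨D, hD⟩ : ∃ D, D = (M₁ \ M₂ ∪ M₁ \ M₃ ∪ M₁ \ M₄) ∪ (M₂ \ M₁ ∪ M₃ \ M₁ ∪ M₄ \ M₁) := ⟨_, rfl⟩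
  have hDc : D.card ≤ 24 := by
    have u₁ := (Finset.card_union_le _ _).trans (Nat.add_le_add_right (Finset.card_union_le (M₁ \ M₂) (M₁ \ M₃))
      (M₁ \ M₄).card)
    have u₂ := (Finset.card_union_le _ _).trans (Nat.add_le_add_right (Finset.card_union_le (M₂ \ M₁) (M₃ \ M₁))
      (M₄ \ M₁).card)
    have u := (Finset.card_union_le _ _).trans (add_le_add u₁ u₂)
    rw [hD]; omega
  have hDm : ∀ e, e ∈ M₁ ∨ e ∈ M₂ ∨ e ∈ M₃ ∨ e ∈ M₄ → ¬(e ∈ M₁ ∧ e ∈ M₂ ∧ e ∈ M₃ ∧ e ∈ M₄) → e ∈ D := by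
    intro e hin hout
    rw [hD, Finset.mem_union, Finset.mem_union, Finset.mem_union, Finset.mem_union, Finset.mem_union,
      Finset.mem_sdiff, Finset.mem_sdiff, Finset.mem_sdiff, Finset.mem_sdiff, Finset.mem_sdiff, Finset.mem_sdiff]
    by_cases h1 : e ∈ M₁
    · by_cases h2 : e ∈ M₂
      · by_cases h3 : e ∈ M₃
        · exact Or.inl (Or.inr ⟨h1, fun h4 => hout ⟨h1, h2, h3, h4⟩⟩)
        · exact Or.inl (Or.inl (Or.inr ⟨h1, h3⟩))
      · exact Or.inl (Or.inl (Or.inl ⟨h1, h2⟩))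
    · rcases hin with h | h | h | h
      exacts [absurd h h1, Or.inr (Or.inl (Or.inl ⟨h, h1⟩)), Or.inr (Or.inl (Or.inr ⟨h, h1⟩)),
        Or.inr (Or.inr ⟨h, h1⟩)]
  obtain ⟨K, hK⟩ : ∃ K, K = M₁ ∩ M₂ ∩ M₃ ∩ M₄ := ⟨_, rfl⟩
  have hKm : ∀ e, e ∈ K ↔ ((e ∈ M₁ ∧ e ∈ M₂) ∧ e ∈ M₃) ∧ e ∈ M₄ := fun e => by
    rw [hK, Finset.mem_inter, Finset.mem_inter, Finset.mem_inter]
  obtain ⟨hK₁, hK₂, hK₃, hK₄⟩ : K ⊆ M₁ ∧ K ⊆ M₂ ∧ K ⊆ M₃ ∧ K ⊆ M₄ := ⟨fun e he => ((hKm e).1 he).1.1.1,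
    fun e he => ((hKm e).1 he).1.1.2, fun e he => ((hKm e).1 he).1.2, fun e he => ((hKm e).1 he).2⟩
  have pj : ∀ {M : Finset ((Fin 3 → Fin (qOf m)) × (Fin 3 → Fin (qOf m)))},
      (∀ e, e ∈ M → e ∈ M₁ ∨ e ∈ M₂ ∨ e ∈ M₃ ∨ e ∈ M₄) → M \ K ⊆ D := by
    intro M hM e he
    rw [Finset.mem_sdiff, hKm] at he
    exact hDm e (hM e he.1) fun h => he.2 ⟨⟨⟨h.1, h.2.1⟩, h.2.2.1⟩, h.2.2.2⟩
  have p₁ : M₁ \ K ⊆ D := pj fun e he => Or.inl he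
  have p₂ : M₂ \ K ⊆ D := pj fun e he => Or.inr (Or.inl he)
  have p₃ : M₃ \ K ⊆ D := pj fun e he => Or.inr (Or.inr (Or.inl he))
  have p₄ : M₄ \ K ⊆ D := pj fun e he => Or.inr (Or.inr (Or.inr he))
  have fac : ∀ {M : Finset ((Fin 3 → Fin (qOf m)) × (Fin 3 → Fin (qOf m)))}, K ⊆ M →
      dprod M = dprod (M \ K) * dprod K := by
    intro M hKM; unfold dprod; rw [Finset.prod_sdiff hKM]
  have hf' : C α₁ * dprod M₁ + C α₂ * dprod M₂ + C α₃ * dprod M₃ + C α₄ * dprod M₄ =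
      (C α₁ * dprod (M₁ \ K) + C α₂ * dprod (M₂ \ K) + C α₃ * dprod (M₃ \ K) + C α₄ * dprod (M₄ \ K)) *
        dprod K := by
    rw [fac hK₁, fac hK₂, fac hK₃, fac hK₄]; ring
  rw [hf'] at hf h0; rw [map_mul] at h0
  have hK0 : bind₁ (kiPer m) (dprod K) ≠ 0 :=
    kiPer_dprod_ne_zero hm3 fun e he => loopless_of_oriented ho₁ e (hK₁ he)
  have hg : C α₁ * dprod (M₁ \ K) + C α₂ * dprod (M₂ \ K) + C α₃ * dprod (M₃ \ K) + C α₄ * dprod (M₄ \ K) ≠ 0 :=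
    fun h => hf (by rw [h, zero_mul])
  refine kiPer_hits_support m hg ?_ ((mul_eq_zero.1 h0).resolve_right hK0)
  -- `f̂` lives on the `≤ 48` endpoints of `D`, and `2 · 47 < 100 ≤ m²`
  have hV : (C α₁ * dprod (M₁ \ K) + C α₂ * dprod (M₂ \ K) + C α₃ * dprod (M₃ \ K) +
      C α₄ * dprod (M₄ \ K)).vars ⊆ D.biUnion fun e => ({e.1, e.2} : Finset (Fin 3 → Fin (qOf m))) := by
    intro v hv
    rcases Finset.mem_union.1 (vars_add_subset _ _ hv) with hv | hv
    · rcases Finset.mem_union.1 (vars_add_subset _ _ hv) with hv | hv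
      · rcases Finset.mem_union.1 (vars_add_subset _ _ hv) with hv | hv
        · exact vars_C_mul_dprod_subset α₁ p₁ hv
        · exact vars_C_mul_dprod_subset α₂ p₂ hv
      · exact vars_C_mul_dprod_subset α₃ p₃ hv
    · exact vars_C_mul_dprod_subset α₄ p₄ hv
  have hVc : (D.biUnion fun e => ({e.1, e.2} : Finset (Fin 3 → Fin (qOf m)))).card ≤ D.card • 2 :=
    Finset.card_biUnion_le.trans (Finset.sum_le_card_nsmul _ _ _ fun _ _ => Finset.card_le_two)
  rw [smul_eq_mul] at hVc
  have hc := Finset.card_le_card hV; have h100 : 10 * 10 ≤ m * m := Nat.mul_le_mul hm hm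
  omega

end Summit.ValiantsHypothesis.ValiantsHypothesis.Theorems.DefinabilityGapFourMatchings
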